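import Mathlib

/-!
# Eigenspace separation (solo-informed, §7.11 (16.11) L6)

The algebraic core of the local argument above `p` in THEOREM D: in `H¹(K_𝔓, 𝔽_p)` the
unramified line is the `ω⁰`-eigenspace of `Δ = Gal(K_𝔓/F_v)`, the Kummer class `κ_η` spans an
`ω^{±1}`-line, and the top class `c` of a Kummer class of degree `k` lies in the `ω^{∓k}`-eigenspace.
If `c` becomes unramified in the extension cut out by `κ_η`, local class field theory puts `c` in
`(unramified) + 𝔽_p κ_η`; when the three eigenvalues are distinct this forces `c = 0`.

Abstractly: for a linear endomorphism `T` of a vector space, a `λ₂`-eigenvector lying in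
`(λ₀-eigenvectors) + (multiples of a λ₁-eigenvector)` vanishes as soon as `λ₂ ∉ {λ₀, λ₁}`.
The proof applies `(T - λ₀)(T - λ₁)`.
-/

namespace Summit.Langlands.Langlands.Theorems

open LinearMap

variable {F M : Type*} [Field F] [AddCommGroup M] [Module F M]

/-- If `c = u + a • κ` with `T u = λ₀ u`, `T κ = λ₁ κ`, `T c = λ₂ c` and `λ₂ ≠ λ₀`, `λ₂ ≠ λ₁`,
then `c = 0`. -/
theorem soloInformed_eigen_separation (T : M →ₗ[F] M) {l0 l1 l2 : F} {u κ c : M}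
    (hu : T u = l0 • u) (hκ : T κ = l1 • κ) (hc : T c = l2 • c)
    (h02 : l2 ≠ l0) (h12 : l2 ≠ l1) (a : F) (h : c = u + a • κ) : c = 0 := by
  -- apply (T - l0) ∘ (T - l1) to both descriptions of c
  have key1 : T (T c) - (l0 + l1) • T c + (l0 * l1) • c = 0 := by
    subst h
    simp only [map_add, map_smul, hu, hκ, smul_smul, smul_add]
    module
  have key2 : T (T c) - (l0 + l1) • T c + (l0 * l1) • c = ((l2 - l0) * (l2 - l1)) • c := by
    rw [hc, map_smul, hc, smul_smul]
    module
  have h3 : ((l2 - l0) * (l2 - l1)) • c = 0 := by rw [← key2, key1]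
  rcases smul_eq_zero.mp h3 with h4 | h4
  · exfalso
    rcases mul_eq_zero.mp h4 with h5 | h5
    · exact h02 (sub_eq_zero.mp h5)
    · exact h12 (sub_eq_zero.mp h5)
  · exact h4

/-- Subspace form: a `λ₂`-eigenvector in `U + F ∙ κ`, where every element of `U` is a
`λ₀`-eigenvector and `κ` is a `λ₁`-eigenvector, vanishes when `λ₂ ∉ {λ₀, λ₁}`.
(In (16.11) L6: `U` = unramified classes, `κ` = the Kummer class, `c` = the top class.) -/
theorem soloInformed_eigen_separation_mem (T : M →ₗ[F] M) {l0 l1 l2 : F}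
    (U : Submodule F M) (hU : ∀ u ∈ U, T u = l0 • u) {κ c : M}
    (hκ : T κ = l1 • κ) (hc : T c = l2 • c) (h02 : l2 ≠ l0) (h12 : l2 ≠ l1)
    (hmem : c ∈ U ⊔ (F ∙ κ)) : c = 0 := by
  rw [Submodule.mem_sup] at hmem
  obtain ⟨u, hu, w, hw, rfl⟩ := hmem
  rw [Submodule.mem_span_singleton] at hw
  obtain ⟨a, rfl⟩ := hw
  exact soloInformed_eigen_separation T (hU u hu) hκ hc h02 h12 a rfl

/-- The degenerate case used for THEOREM D2 (`k = p - 1`, eigenvalue `λ₀` itself is excluded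
only for `κ`): if `c = u + a • κ` is a `λ₀`-eigenvector, `u` is a `λ₀`-eigenvector and `κ` is a
`λ₁`-eigenvector with `λ₁ ≠ λ₀`, then `a • κ = 0`, i.e. `c = u` lies in `U` (is unramified). -/
theorem soloInformed_eigen_separation_same (T : M →ₗ[F] M) {l0 l1 : F} {u κ c : M}
    (hu : T u = l0 • u) (hκ : T κ = l1 • κ) (hc : T c = l0 • c) (h01 : l0 ≠ l1)
    (a : F) (h : c = u + a • κ) : c = u := by
  have key : (a * (l1 - l0)) • κ = 0 := by
    have e1 : T c = l0 • u + (a * l1) • κ := by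
      subst h; simp only [map_add, map_smul, hu, hκ, smul_smul]
    have e2 : T c = l0 • u + (l0 * a) • κ := by
      rw [hc, h, smul_add, smul_smul]
    have e3 : (a * l1) • κ = (l0 * a) • κ := add_left_cancel (e1.symm.trans e2)
    have : (a * l1) • κ - (l0 * a) • κ = 0 := sub_eq_zero.mpr e3
    rw [← sub_smul] at this
    convert this using 2; ring
  rcases smul_eq_zero.mp key with h4 | h4
  · rcases mul_eq_zero.mp h4 with h5 | h5
    · rw [h, h5, zero_smul, add_zero]
    · exact absurd (sub_eq_zero.mp h5).symm h01
  · rw [h, h4, smul_zero, add_zero]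

end Summit.Langlands.Langlands.Theorems
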